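import Mathlib
import HarnessLib
import Summits.KontsevichZagierPeriods.Zeta5Search.Denom.CatalanRayPClosedTwo

/-!
# CatalanRayPClosedInt — the 2-adic half of Theorem K6 and the integrality packaging `d*·d*·2^k·PClosed ∈ ℤ` (cell `pub-zeta5`, fam-denom D9b)
HONEST FRAMING: systematic search; no irrationality claim unless certified.  This file is denominator arithmetic of
an explicit finite sum of rationals; it makes no statement about irrationality.

Last of the four `CatalanRayPClosed*` files (plan and theorem list in the module docstring of
`Denom/CatalanRayPClosed.lean`; 2-adic toolkit and atom bounds in `CatalanRayPClosedTwo.lean`).  PROVED here: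
* the termwise 2-adic bounds on `J ≥ 3n`: `two_termA/two_termBB/two_termBA/two_termG : −(4J+2n) ≤ v₂(term)`
  (paper values `≥ −2J−4n−2c+2`, `−2J−4n−2a`, `−3J−4n−a`, `−2J−3n−2a+1`);
* **`PClosed_twoInt (3n ≤ J) (1 ≤ n) : −((4J+2n : ℕ) : ℤ) ≤ padicValRat 2 (PClosed n J)`** and
  `rayPClosed_twoInt (j ≥ 3) : −2(2j+1)n ≤ v₂(rayPClosed j n)` (the exponent of fam-catalan's `rayMult`);
* `dstarOdd N = ∏_{p odd prime ≤ N} p^{⌊log_p N⌋}` (the same definition as fam-catalan's `CatalanTwoAdicRay.dstarOdd`),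
  `padicValRat_dstarOdd` (`= ⌊log_p N⌋` at odd `p`), `exists_int_of_padicValRat_nonneg`, and the packaging
  **`PClosed_isInt : ∃ z : ℤ, z = d*_{J+n}·d*_{max(J,4n−1)}·2^{4J+2n}·PClosed n J`**,
  **`rayPClosed_isInt (j ≥ 4) (n ≥ 1) : ∃ z : ℤ, z = d*_{(j+1)n}·d*_{jn}·2^{2(2j+1)n}·rayPClosed j n`** —
  `rayMult j n · P ∈ ℤ` in fam-catalan's currency, for the closed form.
NOT typed: the identification of `rayPClosed j n` with the remainder `P_n` of `Jsym n (jn) n ((j+1)n) n` (analytic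
node; see the first file), the rays `j ∈ {1,2,3}` in fam-catalan's envelope.
-/

namespace Summit.KontsevichZagierPeriods.Zeta5Search.Denom.CatalanRayPClosed

open Finset
open Summit.KontsevichZagierPeriods.Zeta5Search.Denom.CatalanRayAtoms
open Summit.KontsevichZagierPeriods.Zeta5Search.Denom.CatalanRayDigits

/-! ### 2-adic term bounds (`J ≥ 3n`): every term has `v₂ ≥ −(4J + 2n)` -/

/-- α: `v₂(termA c) ≥ −2J − 4n − 2c + 2 ≥ −(4J+2n)` (`c ≤ J − n`). -/
theorem two_termA (n J c : ℕ) (hJ : 3 * n ≤ J) (hc : c + n ≤ J) :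
    -((4 * J + 2 * n : ℕ) : ℤ) ≤ padicValRat 2 (termA n J c) := by
  have hk : -((4 * J + 2 * n : ℕ) : ℤ) ≤ 0 := neg_nonpos.mpr (by positivity)
  rcases eq_or_ne (gsumAtom c) 0 with hg | hg
  · rw [termA, hg, mul_zero, mul_zero, padicValRat.zero]; exact hk
  obtain ⟨r, hr⟩ : ∃ r, J = n + r + c := ⟨J - n - c, by omega⟩
  subst hr
  have hC : (Nat.choose (2 * c) c : ℚ) ≠ 0 := by exact_mod_cast (Nat.choose_pos (by omega)).ne'
  have h8 : -(8 * (Nat.choose (2 * c) c : ℚ) / 4 ^ c) ≠ 0 := by rw [neg_ne_zero]; positivity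
  unfold termA
  rw [padicValRat.mul (coef_ne _ _ _ (Nnum_alpha_ne n (n + r) c)) (mul_ne_zero h8 hg), padicValRat.mul h8 hg,
    v2_coef_alpha n (n + r) c (by omega), padicValRat.neg, padicValRat.div (by positivity) (by positivity),
    padicValRat.mul (by norm_num) hC, padicValRat.pow, v2_small.2.2, v2_small.2.1, padicValRat.of_nat,
    show n + r - n = r by omega]
  have hcc := v2_centralBinom c
  have L1 := vf_two_le r
  have L2 := vf_two_le (c + n)
  have L3 := vf_two_le (c + 2 * n)
  have L5 := vf_nonneg 2 c
  have G := gsumAtom_two_ge c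
  push_cast at hcc L2 L3 ⊢
  linarith

/-- β, `B`-part: `v₂(termBB a) ≥ −2J − 4n − 2a ≥ −(4J+2n)` (`1 ≤ a ≤ n`). -/
theorem two_termBB (n J a : ℕ) (hJ : 3 * n ≤ J) (ha1 : 1 ≤ a) (ha : a ≤ n) :
    -((4 * J + 2 * n : ℕ) : ℤ) ≤ padicValRat 2 (termBB n J a) := by
  have hk : -((4 * J + 2 * n : ℕ) : ℤ) ≤ 0 := neg_nonpos.mpr (by positivity)
  rcases eq_or_ne (Watom a) 0 with hW | hW
  · rw [termBB, hW, mul_zero, mul_zero, padicValRat.zero]; exact hk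
  obtain ⟨b, rfl⟩ : ∃ b, a = b + 1 := ⟨a - 1, by omega⟩
  unfold termBB
  rw [padicValRat.mul (coef_ne _ _ _ (Nnum_neg_ne n J (b + 1))) (mul_ne_zero (tB_ne _) hW),
    padicValRat.mul (tB_ne _) hW, v2_coef_beta n J (b + 1) ha1 ha (by omega), v2_tB,
    show b + 1 - 1 = b by omega]
  have L1 := vf_two_le (b + 1 + J - n)
  have L2 := vf_two_le (n - (b + 1))
  have L3 := vf_two_le (2 * n - (b + 1))
  have L4 := vf_two_le (2 * b + 1)
  have L5 := vf_nonneg 2 b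
  have W := Watom_two_ge (b + 1)
  have c1 : ((b + 1 + J - n : ℕ) : ℤ) = b + 1 + J - n := by rw [Nat.cast_sub (by omega)]; push_cast; ring
  have c2 : ((n - (b + 1) : ℕ) : ℤ) = n - (b + 1) := by rw [Nat.cast_sub (by omega)]; push_cast; ring
  have c3 : ((2 * n - (b + 1) : ℕ) : ℤ) = 2 * n - (b + 1) := by rw [Nat.cast_sub (by omega)]; push_cast; ring
  push_cast at L4 W ⊢
  linarith

/-- β, `A′`-part: `v₂(termBA a) ≥ −2J − 4n − a + 1 − ⌊log₂(2(a+J)−1)⌋ ≥ −3J − 4n − a ≥ −(4J+2n)` (`1 ≤ a ≤ n`). -/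
theorem two_termBA (n J a : ℕ) (hJ : 3 * n ≤ J) (ha1 : 1 ≤ a) (ha : a ≤ n) :
    -((4 * J + 2 * n : ℕ) : ℤ) ≤ padicValRat 2 (termBA n J a) := by
  have hk : -((4 * J + 2 * n : ℕ) : ℤ) ≤ 0 := neg_nonpos.mpr (by positivity)
  rcases eq_or_ne (logDer n J (-(a : ℚ))) 0 with hL | hL
  · rw [termBA, hL, mul_zero, zero_mul, padicValRat.zero]; exact hk
  have hlog := logDer_padicValRat_ge' (p := 2) n J a ha1 ha hJ
  have hwin := log_two_window n J a ha hJ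
  have hwin' : (Nat.log 2 (2 * (a + J) - 1) : ℤ) ≤ J + 1 := by exact_mod_cast hwin
  obtain ⟨b, rfl⟩ : ∃ b, a = b + 1 := ⟨a - 1, by omega⟩
  have hσ : sigmaAtom (b + 1) ≠ 0 := (sigmaAtom_pos (b + 1) ha1).ne'
  have h2 : (2 : ℚ) * tB (b + 1) * sigmaAtom (b + 1) ≠ 0 := mul_ne_zero (mul_ne_zero two_ne_zero (tB_ne _)) hσ
  unfold termBA
  rw [padicValRat.mul (mul_ne_zero (coef_ne _ _ _ (Nnum_neg_ne n J (b + 1))) hL) h2,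
    padicValRat.mul (coef_ne _ _ _ (Nnum_neg_ne n J (b + 1))) hL,
    padicValRat.mul (mul_ne_zero two_ne_zero (tB_ne _)) hσ, padicValRat.mul two_ne_zero (tB_ne _),
    v2_coef_beta n J (b + 1) ha1 ha (by omega), v2_tB, v2_small.1, show b + 1 - 1 = b by omega]
  have L1 := vf_two_le (b + 1 + J - n)
  have L2 := vf_two_le (n - (b + 1))
  have L3 := vf_two_le (2 * n - (b + 1))
  have L4 := vf_two_le (2 * b + 1)
  have L5 := vf_nonneg 2 b
  have S := sigmaAtom_two_ge (b + 1)
  have c1 : ((b + 1 + J - n : ℕ) : ℤ) = b + 1 + J - n := by rw [Nat.cast_sub (by omega)]; push_cast; ring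
  have c2 : ((n - (b + 1) : ℕ) : ℤ) = n - (b + 1) := by rw [Nat.cast_sub (by omega)]; push_cast; ring
  have c3 : ((2 * n - (b + 1) : ℕ) : ℤ) = 2 * n - (b + 1) := by rw [Nat.cast_sub (by omega)]; push_cast; ring
  have hJn : (3 * n : ℤ) ≤ J := by exact_mod_cast hJ
  have hbn : ((b + 1 : ℕ) : ℤ) ≤ n := by exact_mod_cast ha
  push_cast at L4 S hbn hlog hwin' ⊢
  linarith

/-- γ: `v₂(termG a) ≥ −2J − 3n − 2a + 1 ≥ −(4J+2n)` (`n < a ≤ 2n`). -/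
theorem two_termG (n J a : ℕ) (hJ : 3 * n ≤ J) (hna : n < a) (ha2 : a ≤ 2 * n) :
    -((4 * J + 2 * n : ℕ) : ℤ) ≤ padicValRat 2 (termG n J a) := by
  obtain ⟨b, rfl⟩ : ∃ b, a = b + 1 := ⟨a - 1, by omega⟩
  have hσ : sigmaAtom (b + 1) ≠ 0 := (sigmaAtom_pos (b + 1) (by omega)).ne'
  unfold termG
  rw [padicValRat.mul (coef_ne _ _ _ (Nnum_neg_ne n J (b + 1)))
      (mul_ne_zero (mul_ne_zero two_ne_zero (tB_ne _)) hσ),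
    padicValRat.mul (mul_ne_zero two_ne_zero (tB_ne _)) hσ, padicValRat.mul two_ne_zero (tB_ne _),
    v2_coef_gamma n J (b + 1) hna ha2, v2_tB, v2_small.1, show b + 1 - 1 = b by omega, show b + 1 - n - 1 = b - n by omega]
  have L1 := vf_two_le (b + 1 + J - n)
  have L3 := vf_two_le (2 * n - (b + 1))
  have L4 := vf_two_le (2 * b + 1)
  have L5 := vf_nonneg 2 b
  have L6 := vf_nonneg 2 (b - n)
  have S := sigmaAtom_two_ge (b + 1)
  have c1 : ((b + 1 + J - n : ℕ) : ℤ) = b + 1 + J - n := by rw [Nat.cast_sub (by omega)]; push_cast; ring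
  have c3 : ((2 * n - (b + 1) : ℕ) : ℤ) = 2 * n - (b + 1) := by rw [Nat.cast_sub (by omega)]; push_cast; ring
  have hJn : (3 * n : ℤ) ≤ J := by exact_mod_cast hJ
  have hb2 : ((b + 1 : ℕ) : ℤ) ≤ 2 * n := by exact_mod_cast ha2
  push_cast at L4 S hb2 ⊢
  linarith

/-! ### The 2-adic half of Theorem K6 for the closed form -/

/-- **`2^{4J+2n} · PClosed(n,J) ∈ ℤ_(2)`** (`J ≥ 3n`, `n ≥ 1`): `v₂(PClosed n J) ≥ −(4J + 2n)`.  On the ray `J = jn`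
the exponent is `2(2j+1)n = 2Wn`, fam-catalan's `rayMult` 2-power. -/
theorem PClosed_twoInt (n J : ℕ) (hJ : 3 * n ≤ J) (hn : 1 ≤ n) :
    -((4 * J + 2 * n : ℕ) : ℤ) ≤ padicValRat 2 (PClosed n J) := by
  have hk : -((4 * J + 2 * n : ℕ) : ℤ) ≤ 0 := neg_nonpos.mpr (by positivity)
  unfold PClosed
  refine le_padicValRat_add _ _ _ hk (le_padicValRat_add _ _ _ hk ?_ ?_) ?_
  · refine le_padicValRat_sum _ _ _ hk (fun c hc => ?_)
    rw [Finset.mem_range] at hc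
    exact two_termA n J c hJ (by omega)
  · refine le_padicValRat_sum _ _ _ hk (fun a ha => ?_)
    rw [Finset.mem_Icc] at ha
    exact le_padicValRat_add _ _ _ hk (two_termBB n J a hJ ha.1 ha.2) (two_termBA n J a hJ ha.1 ha.2)
  · refine le_padicValRat_sum _ _ _ hk (fun a ha => ?_)
    rw [Finset.mem_Icc] at ha
    exact two_termG n J a hJ (by omega) ha.2

/-- ray form: `v₂(rayPClosed j n) ≥ −2(2j+1)n` (`j ≥ 3`, `n ≥ 1`). -/
theorem rayPClosed_twoInt (j n : ℕ) (hj : 3 ≤ j) (hn : 1 ≤ n) :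
    -((2 * (2 * j + 1) * n : ℕ) : ℤ) ≤ padicValRat 2 (rayPClosed j n) := by
  have h := PClosed_twoInt n (j * n) (Nat.mul_le_mul_right n hj) hn
  rw [show 4 * (j * n) + 2 * n = 2 * (2 * j + 1) * n by ring] at h
  exact h

/-! ### Integrality packaging: `d*·d*·2^k·P ∈ ℤ` -/

/-- `d*_N = ∏_{p odd prime ≤ N} p^{⌊log_p N⌋}` — the odd part of `lcm(1..N)` (same definition as fam-catalan's
`CatalanTwoAdicRay.dstarOdd`). -/
def dstarOdd (N : ℕ) : ℕ :=
  ∏ p ∈ (Finset.range (N + 1)).filter (fun p => p.Prime ∧ p ≠ 2), p ^ Nat.log p N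

/-- Small values: `d*_1 = 1`, `d*_3 = 3`, `d*_5 = 15`, `d*_9 = 315`. -/
theorem dstarOdd_small : dstarOdd 1 = 1 ∧ dstarOdd 3 = 3 ∧ dstarOdd 5 = 15 ∧ dstarOdd 9 = 315 := by
  refine ⟨by decide, by decide, by decide, by decide⟩

/-- `v_p(d*_N) = ⌊log_p N⌋` for every odd prime `p`. -/
theorem padicValRat_dstarOdd {p : ℕ} [hp : Fact p.Prime] (hp2 : p ≠ 2) (N : ℕ) :
    padicValRat p ((dstarOdd N : ℕ) : ℚ) = (Nat.log p N : ℤ) := by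
  classical
  unfold dstarOdd
  set S := (Finset.range (N + 1)).filter (fun q => q.Prime ∧ q ≠ 2) with hS
  rw [Nat.cast_prod, ← padicValRat_prod (fun q hq => by
    rw [Finset.mem_filter] at hq
    exact_mod_cast (pow_pos hq.2.1.pos _).ne')]
  have hterm : ∀ q ∈ S, padicValRat p (((q ^ Nat.log q N : ℕ)) : ℚ)
      = if p = q then (Nat.log p N : ℤ) else 0 := by
    intro q hq
    rw [Finset.mem_filter] at hq
    rw [Nat.cast_pow, padicValRat.pow, padicValRat.of_nat]
    by_cases hpq : p = q
    · subst hpq; rw [if_pos rfl, padicValNat_self]; simp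
    · rw [if_neg hpq]
      haveI : Fact q.Prime := ⟨hq.2.1⟩
      rw [padicValNat_primes hpq]; simp
  rw [Finset.sum_congr rfl hterm, Finset.sum_ite_eq]
  by_cases hmem : p ∈ S
  · rw [if_pos hmem]
  · rw [if_neg hmem]
    have hpN : N < p := by
      by_contra hle
      apply hmem
      rw [hS, Finset.mem_filter, Finset.mem_range]
      exact ⟨by omega, hp.out, hp2⟩
    rw [Nat.log_of_lt hpN]; simp

/-- a rational all of whose `p`-adic valuations are non-negative is an integer. -/
theorem exists_int_of_padicValRat_nonneg (x : ℚ) (h : ∀ p : ℕ, p.Prime → 0 ≤ padicValRat p x) :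
    ∃ z : ℤ, (z : ℚ) = x := by
  refine ⟨x.num, Rat.coe_int_num_of_den_eq_one ?_⟩
  by_contra hden
  obtain ⟨p, hp, hpd⟩ := Nat.exists_prime_and_dvd hden
  haveI := Fact.mk hp
  have hv := h p hp
  have hcop : Nat.Coprime x.num.natAbs x.den := x.reduced
  have hnum : ¬ p ∣ x.num.natAbs := by
    intro hpn
    have h1 : p ∣ Nat.gcd x.num.natAbs x.den := Nat.dvd_gcd hpn hpd
    rw [hcop.gcd_eq_one] at h1
    exact hp.one_lt.ne' (Nat.dvd_one.mp h1)
  have hvn : padicValInt p x.num = 0 := by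
    unfold padicValInt; exact padicValNat.eq_zero_of_not_dvd hnum
  have hvd : 1 ≤ padicValNat p x.den := one_le_padicValNat_of_dvd x.den_nz hpd
  unfold padicValRat at hv
  rw [hvn] at hv
  have : (1 : ℤ) ≤ (padicValNat p x.den : ℤ) := by exact_mod_cast hvd
  push_cast at hv
  linarith

/-- **Theorem K6 for the closed form, both halves, packaged**: for `J ≥ 3n`, `n ≥ 1`,
`d*_{J+n} · d*_{max(J,4n−1)} · 2^{4J+2n} · PClosed(n,J)` is an integer. -/
theorem PClosed_isInt (n J : ℕ) (hJ : 3 * n ≤ J) (hn : 1 ≤ n) :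
    ∃ z : ℤ, (z : ℚ) = ((dstarOdd (J + n) * dstarOdd (max J (4 * n - 1)) : ℕ) : ℚ) * 2 ^ (4 * J + 2 * n)
      * PClosed n J := by
  rcases eq_or_ne (PClosed n J) 0 with h0 | h0
  · exact ⟨0, by rw [h0]; simp⟩
  apply exists_int_of_padicValRat_nonneg
  intro p hp
  haveI := Fact.mk hp
  have hpos : ∀ N, 0 < dstarOdd N := fun N => by
    unfold dstarOdd
    exact Finset.prod_pos (fun p hp => pow_pos (Finset.mem_filter.mp hp).2.1.pos _)
  have hd1 : ((dstarOdd (J + n) : ℕ) : ℚ) ≠ 0 := by exact_mod_cast (hpos _).ne'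
  have hd2 : ((dstarOdd (max J (4 * n - 1)) : ℕ) : ℚ) ≠ 0 := by exact_mod_cast (hpos _).ne'
  have h2k : (2 : ℚ) ^ (4 * J + 2 * n) ≠ 0 := by positivity
  rw [Nat.cast_mul, padicValRat.mul (mul_ne_zero (mul_ne_zero hd1 hd2) h2k) h0,
    padicValRat.mul (mul_ne_zero hd1 hd2) h2k, padicValRat.mul hd1 hd2, padicValRat.pow]
  by_cases hp2 : p = 2
  · subst hp2
    have hP := PClosed_twoInt n J hJ hn
    have e1 : (0 : ℤ) ≤ padicValRat 2 ((dstarOdd (J + n) : ℕ) : ℚ) := by rw [padicValRat.of_nat]; positivity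
    have e2 : (0 : ℤ) ≤ padicValRat 2 ((dstarOdd (max J (4 * n - 1)) : ℕ) : ℚ) := by
      rw [padicValRat.of_nat]; positivity
    rw [v2_small.1]
    push_cast at hP ⊢
    linarith
  · have hP := PClosed_oddInt n J hJ hn p hp2
    rw [padicValRat_dstarOdd hp2, padicValRat_dstarOdd hp2, v_two hp2, mul_zero]
    linarith

/-- **On the rays `j ≥ 4`**: `d*_{(j+1)n} · d*_{jn} · 2^{2(2j+1)n} · rayPClosed j n ∈ ℤ` — the integrality that
fam-catalan's `RayIntegrality j` asserts for the remainder `P_n`, here for the explicit closed form (the envelope is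
fam-catalan's `rayMult j n`; for `j = 3` the second factor is `d*_{max(3n,4n−1)} = d*_{4n−1}`, see `PClosed_isInt`). -/
theorem rayPClosed_isInt (j n : ℕ) (hj : 4 ≤ j) (hn : 1 ≤ n) :
    ∃ z : ℤ, (z : ℚ) = ((dstarOdd ((j + 1) * n) * dstarOdd (j * n) : ℕ) : ℚ) * 2 ^ (2 * (2 * j + 1) * n)
      * rayPClosed j n := by
  have h := PClosed_isInt n (j * n) (le_trans (by omega : 3 * n ≤ 4 * n) (Nat.mul_le_mul_right n hj)) hn
  have hmax : max (j * n) (4 * n - 1) = j * n :=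
    max_eq_left (by have := Nat.mul_le_mul_right n hj; omega)
  rw [hmax, show j * n + n = (j + 1) * n by ring, show 4 * (j * n) + 2 * n = 2 * (2 * j + 1) * n by ring] at h
  exact h

end Summit.KontsevichZagierPeriods.Zeta5Search.Denom.CatalanRayPClosed
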